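import Summits.BirchSwinnertonDyer.Rank1Residual.Additive.X4KimLargeImageKuriharaCertificate
import Summits.BirchSwinnertonDyer.Rank1Residual.Additive.GordManinConstantDegree
import Summits.BirchSwinnertonDyer.Rank1Residual.Supersingular.TowerSurjectivitySemistable
import Summits.BirchSwinnertonDyer.Rank1Residual.Supersingular.TowerSurjectivityOfFrobenius
import Literature.NumberTheory.EllipticCurves.ModularCurvePeriodRatio
import Literature.NumberTheory.EllipticCurves.PAdicLFunctionNeZeroProofs
import Literature.NumberTheory.EllipticCurves.RootNumberProofs
import HarnessLib

/-!
# Class X8 (`p = 3` good supersingular, `a_3 = ±3`) under `3`-adic tower surjectivity, analytic rank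
# ZERO (class N6): BOTH halves of `BSD(E,3)` from ONE unit Kurihara number at `3` — CONDITIONAL on the
# announced Kim 2025 (arXiv:2505.09121, PREPRINT) structure theorem (cell `b2b-bsdres`, supersingular
# family, prover B = unit `b2b-bsdres-additive-p3`, gen 17; CLASS-CLOSURE lane §3.12: classes N6 =
# X8 ∧ r = 0 here, O3 = X8 ∧ r = 1 in the sibling `X8KimLargeImageRankOneOPEN.lean`; class lead additive-p3)

HONEST FRAMING (run/shared/lean/b2b/bsd-rank1-residual/, verbatim in every file): the goal of the
cell is to DELETE the COMBINATION-SHAPED residual classes of the Birch–Swinnerton-Dyer formula for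
ALL analytic-rank `≤ 1` elliptic curves over `ℚ` — "full BSD formula for every rank `≤ 1` curve in
class `C`" assembled STRICTLY from published theorems — so that the rank-`≤ 1` remainder becomes
exactly the CONSTRUCTION-SHAPED classes, which are TYPED (missing-input `Prop`s), NOT attempted.
This is not "finishing BSD". Research route; no claim beyond the stated classes. X8 stays
CONSTRUCTION-SHAPED; per pair only; nothing about any curve is asserted; nothing is booked; no mark
of RESIDUAL-MAP §I (N6 / O3) moves. An ANNOUNCED preprint enters ONLY as an explicitly labelled OPEN
hypothesis: every theorem below carrying `hKim25u : Kim2025.…_OPEN` is CONDITIONAL on the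
unrefereed arXiv:2505.09121v1 (C.-H. Kim, appendix with R. Pollack, *The refined Tamagawa number
conjectures for `GL₂`*, 2025); its `p = 3` Kolyvagin-system input, R. Sakamoto, J. Théor. Nombres
Bordeaux 36 (2024) 919–946, IS refereed. Theorems only (pure compositions of tree theorems BY NAME);
no definition, no named fact minted here (debt 0).

## Why X8 (brief for prover B: "r = 0 per pair via Kim/Kurihara certificates where surj(3)")

Gen 2's `Supersingular/SharpFlatKuriharaRoute.lean` (p208229) reached `BSD(E,3)` on X8 ∧ `r_an = 0`
from one unit mod-`3` Kurihara number only THROUGH the ♯/♭ chain (Wuthrich Prop. 21, a chromatic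
datum with (K•)/(P•), the DISPLAYED bridge `hKKS` = Kim–Kim–Sun 2020 ∘ Sprung 2012 Prop. 7.19, flag
`KKS20@3-MR-H4`). Since then: (a) the `p = 3` Kolyvagin-system theory is REFEREED (Sakamoto, JTNB 36
(2024) Thm. 1.1) and Kim's structure theorem is ANNOUNCED at every `p ≥ 3` under LARGE `p`-adic
image, "independent of weight or the local behavior of `f` at `p`" (Kim 2025 Thm. 1.1 / 1.2 (rk0) /
Cor. 1.7) — typed by seat n1011-p09 as the OPEN `Prop`s of `Kim2025/LargeImageStructureOPEN.lean`
(p249366: `3 ≤ p`, `ρ̄_{E,p^n}` onto ∀ `n`, ANY reduction at `p`); (b) on X8 the `3`-adic TOWER is a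
THEOREM from surj(3) + (ram@3) (`ClassX8.towerSurj_of_surj_of_ram`, p249251), from semistability +
modularity + Ribet–Diamond (`ClassX8.towerSurj_of_semistable`, p249601), or from surj(3) + one
Frobenius mod `9` (`ClassX8.towerSurj_of_frobenius`, p250381; gen-16 census: a witness on every X8
S-b pair with `ρ̄_{E,3}` onto). So the OPEN `Prop`s apply to X8 VERBATIM, and two of their binders
are DISCHARGED on X8 by published named facts: the period transfer `Ω(W) = u·Ω⁺_f`, `|u|₃ = 1`
(`realPeriodRat_eq_unit_mul_plusPeriod_three`: Greenberg–Vatsal 2000 Rem. 3.4 + Mazur 1978 Cor. 4.1 +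
Edixhoven 1991 at a GOOD `3` with `E[3]` irreducible, `ClassX8.irr`) and the Manin binder `3 ∤ c_D`
at the conductor level from `3 ∤ deg(D)` (Česnavičius–Neururer–Saha 2024 Thm. 1.2 = A159 `hCNS`,
`f₃(E) = 0`).

## Contents (all per pair; every theorem conditional on the OPEN input it names)

* §0: `three_le_of_classX8`, `ClassX8.periodTransfer`, `ClassX8.condExp_three_eq_zero`,
  `ClassX8.not_three_dvd_maninConstant_of_not_dvd_modularDegree`.
* §1 (N6 = X8 ∧ `r_an = 0`, tower): EXACT BOUNDARY `BSD(E,3) ⟺ 3 ∤ ∏ c_ℓ` given one unit Kurihara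
  number at a cyclic level (`X4.KuriharaUnitAt W 3 D.f`, p199308); `BSD(E,3) ∧ MissingPPartAt W 3`
  on the `3 ∤ ∏ c_ℓ` rows WHATEVER `ord₃ #Ш_an` is (the `9 ∣ #Ш_an` core of N6 included); the other
  side on `3 ∣ ∏ c_ℓ`; tower-fed forms `…_of_ram / _of_semistable / _of_frobenius`; and the
  all-binders-discharged conductor-level form (inputs: the OPEN `Prop`, A159, the period fact, GZK,
  modularity + census certificates surj(3), `(ℓ, a_ℓ mod 9)`, `3 ∤ deg φ`, `3 ∤ ∏ c_ℓ`, one unit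
  `δ̃_n`). NO ♯/♭ datum, NO Wuthrich Prop. 21, NO displayed bridge.
* (sibling `X8KimLargeImageRankOneOPEN.lean`, O3 = X8 ∧ `r_an = 1`, tower: `#Ш(E/ℚ)(3) = 1` from a
  PRIME-level unit `X4.KuriharaUnitPrimeAt`, `BSD(E,3) ⟺ ord₃ #Ш_an = 0`; tower-fed forms.)

NOT claimed: no class theorem; the OPEN `Prop`s are weaker-than-print shapes of an UNREFEREED claim
(flag `Kim2025-OmegaE-integrality` of the Literature file applies); N6's `3 ∣ ∏ c_ℓ` rows need
level-`𝒩₂` numbers (Kim–Pollack §8.1.2), not typed; the 3Nn pairs (`ρ̄_{E,3}` not onto) have no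
Kolyvagin prime with cyclic `3`-part (`GaloisImage/KolyvaginPrimeSmallImage.lean`) and are outside
every theorem here. Census pointers (the census files' numbers): N6 = 178 cells (108 surj(3) + 70
3Nn), O3 = 819; S-b X8 3 211 pairs, 200 3Nn; instrument = CLASS-CLOSURE B-4 (cc-eng-6, Kurihara
numbers at `3`). Memo: HOME/class-closure/N6/WEEK-2026-08-28.md §2.

References: [Kim2025RefinedTNC] Thm. 1.1, 1.2 (rk0), Cor. 1.7, §3.2.2, §8.1; [Sakamoto2024KolyvaginThree]
Thm. 1.1; [Kim2022StructureSelmer] Thm. 1.9, §1.2.5; [CesnaviciusNeururerSaha2023] Thm. 1.2;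
Greenberg–Vatsal 2000 Rem. 3.4, Mazur 1978 Cor. 4.1, Edixhoven 1991 Prop. 2; Serre 1972 Prop. 12 /
21; Silverman AEC VII.5.1, ATAEC IV.10.2; [Miller2011LMS] Def. 1.1.
-/

noncomputable section

open scoped Classical MatrixGroups ModularForm

open CongruenceSubgroup WeierstrassCurve Literature.NumberTheory.EllipticCurves
  Literature.NumberTheory.EllipticCurves.ModularForms
  Literature.NumberTheory.EllipticCurves.Rank1Residual
  Literature.NumberTheory.EllipticCurves.Rank1Residual.Typed
  Summit.BirchSwinnertonDyer.Rank1Residual.Additive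

namespace Summit.BirchSwinnertonDyer.Rank1Residual.Supersingular

variable (W : WeierstrassCurve ℚ) [W.IsElliptic] [W.IsGloballyMinimal] (p : ℕ) [hp : Fact p.Prime]

/-! ### §0 X8 bookkeeping: `3 ≤ p`, the period transfer, `f₃ = 0`, the Manin binder from the degree -/

omit [W.IsElliptic] in
/-- On class X8 the prime IS `3`, so `3 ≤ p`. [folklore] -/
theorem three_le_of_classX8 (hX : ClassX8 W p) : 3 ≤ p := by
  obtain ⟨rfl, -⟩ := hX
  exact le_rfl

/-- **The period transfer on X8 is a PUBLISHED fact**: for every newform `f` of `W`,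
`Ω(W) = u · Ω⁺_f` with `|u|₃ = 1` — the named fact `realPeriodRat_eq_unit_mul_plusPeriod_three`
(Greenberg–Vatsal 2000 Rem. 3.4 with Mazur 1978 Cor. 4.1 and Edixhoven 1991 Prop. 2) at a prime of
GOOD reduction `3` with `E[3]` irreducible, both automatic on X8 (`ClassX8.irr`, Serre 1972 Prop. 12).
[cite: GreenbergVatsal2000, §3, Remark 3.4] [cite: Mazur1978, Cor. 4.1] [cite: Serre1972, §1.11 Prop. 12] -/
theorem ClassX8.periodTransfer (h3per : realPeriodRat_eq_unit_mul_plusPeriod_three) (hX : ClassX8 W p)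
    {N : ℕ} [NeZero N] (f : CuspForm (Gamma0 N) 2) (hf : IsNewformOf W f) :
    ∃ u : ℚ, ‖(u : ℚ_[p])‖ = 1 ∧ W.realPeriodRat = u * plusPeriod f := by
  have hp3 : p = 3 := hX.1
  subst hp3
  exact h3per W hX.2.1.1 (ClassX8.irr W 3 hX) f hf

/-- **On X8 the conductor exponent at `3` vanishes** (`f₃(E) = 0`: good reduction at `3`; Silverman
ATAEC IV.10.2(a) via the tree's `conductorExponent_eq_zero_of_hasGoodReductionAt` and the
prime/place comparison `hasGoodReductionAtPrime_iff_hasGoodReductionAt_holds`).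
[cite: Silverman1994, IV.10.2(a)] [cite: SilvermanAEC2009, VII.5 Prop. 5.1(a)] -/
theorem ClassX8.condExp_three_eq_zero (hX : ClassX8 W p) :
    haveI : Fact (Nat.Prime 3) := ⟨Nat.prime_three⟩; condExp W 3 = 0 := by
  haveI : Fact (Nat.Prime 3) := ⟨Nat.prime_three⟩
  have hgood : W.HasGoodReductionAtPrime 3 := hX.2.1.1
  have hv : W.HasGoodReductionAt (placeOf 3) :=
    (W.hasGoodReductionAtPrime_iff_hasGoodReductionAt_holds ⟨3, Nat.prime_three⟩).mp hgood
  exact conductorExponent_eq_zero_of_hasGoodReductionAt (placeOf 3) W hv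

/-- **The Manin binder on X8 from ONE class integer**: for a parametrisation datum `D` of `W` at the
conductor level with `3 ∤ deg(D)`, `3 ∤ c(D)` — Česnavičius–Neururer–Saha, JEMS 26 (2024) Thm. 1.2
(named fact `hCNS`, A159: `val_p(c_φ) ≤ val_p(deg φ)` outside the printed exceptional clause, which
at `p = 3` needs `val_3(N) ≥ 3` and is void here since `f₃ = 0`), through additive-p2's
`not_three_dvd_maninConstant_of_condExp_le_two_of_not_dvd_modularDegree`. ANY member of the isogeny
class (no optimality). [cite: CesnaviciusNeururerSaha2023, Thm. 1.2] -/
theorem ClassX8.not_three_dvd_maninConstant_of_not_dvd_modularDegree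
    (hCNS : cesnaviciusNeururerSaha_padicVal_maninConstant_le_modularDegree) (hX : ClassX8 W p)
    [NeZero (W.conductorNorm ℤ)] (D : ModularParametrizationData W (W.conductorNorm ℤ))
    (hdeg : ¬ 3 ∣ D.modularDegree) : ¬ (3 : ℤ) ∣ D.maninConstant := by
  haveI : Fact (Nat.Prime 3) := ⟨Nat.prime_three⟩
  have h0 := ClassX8.condExp_three_eq_zero W p hX
  exact not_three_dvd_maninConstant_of_condExp_le_two_of_not_dvd_modularDegree hCNS W D
    (by rw [h0]; norm_num) hdeg

/-! ### §1 N6 = X8 ∧ `r_an = 0` under the `3`-adic tower: the exact boundary and BOTH halves of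
`BSD(E,3)` from ONE unit Kurihara number (OPEN input `hKim25u`) -/

/-- **X8 ∧ `r_an = 0` ∧ tower: `BSD(E,3) ⟺ 3 ∤ ∏ c_ℓ` given ONE unit Kurihara number at a cyclic
level** (typed input `X4.KuriharaUnitAt W 3 D.f`, p199308: `n ∈ 𝒩₁` square-free, `#Ẽ(𝔽_ℓ)[3] ≤ 3`
at `ℓ ∣ n`, surjective discrete logarithms, `kuriharaNumber D.f 3 n ψ ≠ 0`), CONDITIONAL on the
announced Kim 2025 Thm. 1.1 / Cor. 1.7 unit clause at `p = 3` under large `3`-adic image (`hKim25u`,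
OPEN; its `p = 3` Kolyvagin systems = Sakamoto 2024, refereed); Gross–Zagier–Kolyvagin `hGZK`;
modularity `hmod` (reads `r_an = 0` as `L(E,1) ≠ 0`); the period transfer DISCHARGED by the published
`h3per` (`ClassX8.periodTransfer`); `D` a parametrisation datum with `3 ∤ c_D`. Good supersingular
reduction at `3` is "any reduction" for the OPEN `Prop`; `E[3]` irreducible kills the torsion term.
The `p ≥ 5` published twin is additive-p3's `X4.bsdp_iff_not_dvd_tamagawaProduct_of_kim_rankZero`.
Per pair; NOT a class theorem; nothing booked. [claim: Kim2025RefinedTNC, status: under-review]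
[cite: Kim2025RefinedTNC, Thm. 1.1 ("BSD"), Thm. 1.2 (rk0), Cor. 1.7 (ANNOUNCED, OPEN binder)]
[cite: Sakamoto2024KolyvaginThree, Thm. 1.1 = Thm. 4.4 (p. 920)] [cite: GreenbergVatsal2000, §3, Remark 3.4]
[cite: Miller2011LMS, Def. 1.1] -/
theorem X8RankZero.bsdp_iff_not_dvd_tamagawaProduct_of_kim2025_OPEN_of_kuriharaUnitAt
    (hKim25u : Kim2025.rankZero_padicValRat_sha_of_kuriharaNumber_ne_zero_of_towerSurj_OPEN)
    (hGZK : rank_eq_analyticRank_of_analyticRank_le_one) (hmod : hasEntireLFunction_rat)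
    (h3per : realPeriodRat_eq_unit_mul_plusPeriod_three)
    (hr : W.analyticRank = 0) (hX : ClassX8 W p)
    (htower : ∀ n : ℕ, W.HasSurjectiveModNGaloisRep (p ^ n : ℕ))
    {N : ℕ} [NeZero N] (D : ModularParametrizationData W N) (hc : ¬ (p : ℤ) ∣ D.maninConstant)
    (hK : X4.KuriharaUnitAt W p D.f) : BSDp W p ↔ ¬ p ∣ W.tamagawaProduct := by
  obtain ⟨n, hn0, hn, hcyc, ψ, hψ, hδ⟩ := hK
  exact bsdp_iff_not_dvd_tamagawaProduct_of_kim2025_OPEN_rankZero W p hKim25u hGZK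
    (three_le_of_classX8 W p hX) htower ((W.analyticRank_eq_zero_iff_holds (hmod W)).mp hr) D hc
    (ClassX8.periodTransfer W p h3per hX D.f D.isNewformOf) n hn hcyc ψ hψ hδ

/-- **Both halves of `BSD(E,3)` on N6's `3 ∤ ∏ c_ℓ` rows from ONE unit Kurihara number**: X8 ∧
`r_an = 0` ∧ tower ∧ `3 ∤ c_D` ∧ `3 ∤ ∏ c_ℓ` + `X4.KuriharaUnitAt W 3 D.f` ⟹ `BSD(E,3)` and the
typed missing output `MissingPPartAt W 3` — WHATEVER `ord₃ #Ш_an` is (the `9 ∣ #Ш_an` core of N6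
included), with NO ♯/♭ datum, NO Wuthrich Prop. 21 and NO displayed bridge; CONDITIONAL on `hKim25u`
(OPEN). Compare gen 2's `X8.bsdp_of_kuriharaUnitAt_of_kksBridge_of_analyticRank_eq_zero` (p208229:
same certificate, but through (MC↓) of a chromatic datum and the displayed KKS ∘ Prop. 7.19 bridge).
Per pair; NOT a class theorem; nothing booked. [claim: Kim2025RefinedTNC, status: under-review]
[cite: Kim2025RefinedTNC, Thm. 1.1, Cor. 1.7 (ANNOUNCED, OPEN binder)] [cite: Sakamoto2024KolyvaginThree, Thm. 1.1 = Thm. 4.4 (p. 920)]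
[cite: Miller2011LMS, Def. 1.1] -/
theorem X8RankZero.bsdp_of_kim2025_OPEN_of_kuriharaUnitAt
    (hKim25u : Kim2025.rankZero_padicValRat_sha_of_kuriharaNumber_ne_zero_of_towerSurj_OPEN)
    (hGZK : rank_eq_analyticRank_of_analyticRank_le_one) (hmod : hasEntireLFunction_rat)
    (h3per : realPeriodRat_eq_unit_mul_plusPeriod_three)
    (hr : W.analyticRank = 0) (hX : ClassX8 W p)
    (htower : ∀ n : ℕ, W.HasSurjectiveModNGaloisRep (p ^ n : ℕ))
    {N : ℕ} [NeZero N] (D : ModularParametrizationData W N) (hc : ¬ (p : ℤ) ∣ D.maninConstant)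
    (htam : ¬ p ∣ W.tamagawaProduct) (hK : X4.KuriharaUnitAt W p D.f) :
    BSDp W p ∧ MissingPPartAt W p := by
  have hB : BSDp W p :=
    (X8RankZero.bsdp_iff_not_dvd_tamagawaProduct_of_kim2025_OPEN_of_kuriharaUnitAt W p hKim25u hGZK
      hmod h3per hr hX htower D hc hK).mpr htam
  haveI : Finite W.sha := (hGZK W (by rw [hr]; exact zero_le_one)).2
  exact ⟨hB, missingPPartAt_of_bsdp W p hB⟩

/-- **The other side of the boundary on N6**: on X8 ∧ `r_an = 0` ∧ tower with `3 ∣ ∏ c_ℓ`, granted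
`BSD(E,3)` the typed input `X4.KuriharaUnitAt W 3 D.f` FAILS — every mod-`3` Kurihara number at every
cyclic level of `𝒩₁` vanishes; those TAM-DEFECT rows need the level-`𝒩₂` numbers (Kim–Pollack App.
§8.1.2). CONDITIONAL on `hKim25u` (OPEN). Per pair. [claim: Kim2025RefinedTNC, status: under-review]
[cite: Kim2025RefinedTNC, Thm. 1.1, §8.1.2 (ANNOUNCED, OPEN binder)] [cite: Miller2011LMS, Def. 1.1] -/
theorem X8RankZero.not_kuriharaUnitAt_of_kim2025_OPEN_of_bsdp_of_dvd_tamagawaProduct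
    (hKim25u : Kim2025.rankZero_padicValRat_sha_of_kuriharaNumber_ne_zero_of_towerSurj_OPEN)
    (hGZK : rank_eq_analyticRank_of_analyticRank_le_one) (hmod : hasEntireLFunction_rat)
    (h3per : realPeriodRat_eq_unit_mul_plusPeriod_three)
    (hr : W.analyticRank = 0) (hX : ClassX8 W p)
    (htower : ∀ n : ℕ, W.HasSurjectiveModNGaloisRep (p ^ n : ℕ))
    {N : ℕ} [NeZero N] (D : ModularParametrizationData W N) (hc : ¬ (p : ℤ) ∣ D.maninConstant)
    (htam : p ∣ W.tamagawaProduct) (hB : BSDp W p) : ¬ X4.KuriharaUnitAt W p D.f := fun hK =>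
  (X8RankZero.bsdp_iff_not_dvd_tamagawaProduct_of_kim2025_OPEN_of_kuriharaUnitAt W p hKim25u hGZK hmod
    h3per hr hX htower D hc hK).mp hB htam

/-- **N6, tower from surj(3) + (ram@3)** (gen 16's `ClassX8.towerSurj_of_surj_of_ram`; census: (ram@3)
holds on 2 897 of the 3 211 X8 S-b pairs, all 912 semistable ones included): `BSD(E,3)` on X8 ∧
`r_an = 0` ∧ surj(3) ∧ (ram@3) ∧ `3 ∤ c_D · ∏ c_ℓ` from one unit Kurihara number, CONDITIONAL on
`hKim25u` (OPEN). Per pair. [claim: Kim2025RefinedTNC, status: under-review]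
[cite: Kim2025RefinedTNC, Thm. 1.1, Cor. 1.7 (ANNOUNCED, OPEN binder)] [cite: SerreAbelianLadic1968, Ch. IV §3.4 and A.1.2]
[cite: Miller2011LMS, Def. 1.1] -/
theorem X8RankZero.bsdp_of_kim2025_OPEN_of_kuriharaUnitAt_of_ram
    (hKim25u : Kim2025.rankZero_padicValRat_sha_of_kuriharaNumber_ne_zero_of_towerSurj_OPEN)
    (hGZK : rank_eq_analyticRank_of_analyticRank_le_one) (hmod : hasEntireLFunction_rat)
    (h3per : realPeriodRat_eq_unit_mul_plusPeriod_three)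
    (hr : W.analyticRank = 0) (hX : ClassX8 W p) (hs : Surj W p) (hram : Ram W p)
    {N : ℕ} [NeZero N] (D : ModularParametrizationData W N) (hc : ¬ (p : ℤ) ∣ D.maninConstant)
    (htam : ¬ p ∣ W.tamagawaProduct) (hK : X4.KuriharaUnitAt W p D.f) : BSDp W p :=
  (X8RankZero.bsdp_of_kim2025_OPEN_of_kuriharaUnitAt W p hKim25u hGZK hmod h3per hr hX
    (ClassX8.towerSurj_of_surj_of_ram W p hX hs hram) D hc htam hK).1

/-- **N6 ∩ {sst}, tower from modularity + Ribet–Diamond level-lowering** (gen 16's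
`ClassX8.towerSurj_of_semistable`: surj(3) by Serre Prop. 21 i), (ram@3) by `hmod'` + `hLL`, then
Serre's transvection lifting — no certificate at all): `BSD(E,3)` on X8 ∧ sst ∧ `r_an = 0` ∧
`3 ∤ c_D · ∏ c_ℓ` from one unit Kurihara number, CONDITIONAL on `hKim25u` (OPEN). Per pair.
[claim: Kim2025RefinedTNC, status: under-review] [cite: Kim2025RefinedTNC, Thm. 1.1, Cor. 1.7 (ANNOUNCED, OPEN binder)]
[cite: Ribet1990, Thm. 1.1] [cite: Diamond1995RefinedSerre, Thm. 1.1] [cite: Serre1972, §5.4 Prop. 21 i)]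
[cite: Miller2011LMS, Def. 1.1] -/
theorem X8RankZero.bsdp_of_kim2025_OPEN_of_kuriharaUnitAt_of_semistable
    (hKim25u : Kim2025.rankZero_padicValRat_sha_of_kuriharaNumber_ne_zero_of_towerSurj_OPEN)
    (hGZK : rank_eq_analyticRank_of_analyticRank_le_one) (hmod : hasEntireLFunction_rat)
    (h3per : realPeriodRat_eq_unit_mul_plusPeriod_three)
    (hmod' : exists_isNewformOf) (hLL : Literature.NumberTheory.Automorphic.diamond1995_refinedSerre)
    (hr : W.analyticRank = 0) (hX : ClassX8 W p) (hsst : Semistable W)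
    {N : ℕ} [NeZero N] (D : ModularParametrizationData W N) (hc : ¬ (p : ℤ) ∣ D.maninConstant)
    (htam : ¬ p ∣ W.tamagawaProduct) (hK : X4.KuriharaUnitAt W p D.f) : BSDp W p :=
  (X8RankZero.bsdp_of_kim2025_OPEN_of_kuriharaUnitAt W p hKim25u hGZK hmod h3per hr hX
    (ClassX8.towerSurj_of_semistable W p hmod' hLL hX hsst) D hc htam hK).1

/-- **N6, tower from surj(3) + ONE Frobenius mod `9`** (gen 16's `ClassX8.towerSurj_of_frobenius`,
lit-kato's certificate: a good `ℓ ≡ 2, 5 (mod 9)` with `a_ℓ ≡ 3, 6 (mod 9)`; census witness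
`ℓ ≤ 1000` on every X8 S-b pair with `ρ̄_{E,3}` onto): `BSD(E,3)` on X8 ∧ `r_an = 0` ∧ surj(3) ∧
`3 ∤ c_D · ∏ c_ℓ` from one unit Kurihara number, CONDITIONAL on `hKim25u` (OPEN). Per pair.
[claim: Kim2025RefinedTNC, status: under-review] [cite: Kim2025RefinedTNC, Thm. 1.1, Cor. 1.7 (ANNOUNCED, OPEN binder)]
[cite: SerreAbelianLadic1968, Ch. IV §3.4, Lemma 3 (IV-23)] [cite: Miller2011LMS, Def. 1.1] -/
theorem X8RankZero.bsdp_of_kim2025_OPEN_of_kuriharaUnitAt_of_frobenius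
    (hKim25u : Kim2025.rankZero_padicValRat_sha_of_kuriharaNumber_ne_zero_of_towerSurj_OPEN)
    (hGZK : rank_eq_analyticRank_of_analyticRank_le_one) (hmod : hasEntireLFunction_rat)
    (h3per : realPeriodRat_eq_unit_mul_plusPeriod_three)
    (hr : W.analyticRank = 0) (hX : ClassX8 W p) (hs : Surj W p)
    (ℓ : ℕ) [Fact ℓ.Prime] (hgood : W.HasGoodReductionAtPrime ℓ)
    (hℓ9 : ℓ % 9 = 2 ∨ ℓ % 9 = 5) (ha9 : W.frobeniusTrace ℓ % 9 = 3 ∨ W.frobeniusTrace ℓ % 9 = 6)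
    {N : ℕ} [NeZero N] (D : ModularParametrizationData W N) (hc : ¬ (p : ℤ) ∣ D.maninConstant)
    (htam : ¬ p ∣ W.tamagawaProduct) (hK : X4.KuriharaUnitAt W p D.f) : BSDp W p :=
  (X8RankZero.bsdp_of_kim2025_OPEN_of_kuriharaUnitAt W p hKim25u hGZK hmod h3per hr hX
    (ClassX8.towerSurj_of_frobenius W p hX hs ℓ hgood hℓ9 ha9) D hc htam hK).1

/-- **N6, EVERY binder discharged down to census certificates and named facts** (the shape the
CLASS-CLOSURE instrument B-4 feeds): X8 ∧ `r_an = 0` at `3`, a conductor-level parametrisation datum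
`D` with `3 ∤ deg(D)` (⟹ `3 ∤ c_D` by A159 `hCNS`, `f₃ = 0`), surj(3) + one Frobenius mod `9` (⟹ the
tower), `3 ∤ ∏ c_ℓ`, ONE unit Kurihara number at a cyclic level ⟹ `BSD(E,3)` — CONDITIONAL on the
announced `hKim25u` (OPEN); published named facts: A159, the period transfer at `3`, GZK,
modularity. Per pair; NOT a class theorem; nothing booked. [claim: Kim2025RefinedTNC, status: under-review]
[cite: Kim2025RefinedTNC, Thm. 1.1, Cor. 1.7 (ANNOUNCED, OPEN binder)] [cite: CesnaviciusNeururerSaha2023, Thm. 1.2]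
[cite: GreenbergVatsal2000, §3, Remark 3.4] [cite: SerreAbelianLadic1968, Ch. IV §3.4, Lemma 3 (IV-23)]
[cite: Miller2011LMS, Def. 1.1] -/
theorem X8RankZero.bsdp_three_of_kim2025_OPEN_of_frobenius_of_not_dvd_modularDegree
    (hKim25u : Kim2025.rankZero_padicValRat_sha_of_kuriharaNumber_ne_zero_of_towerSurj_OPEN)
    (hCNS : cesnaviciusNeururerSaha_padicVal_maninConstant_le_modularDegree)
    (hGZK : rank_eq_analyticRank_of_analyticRank_le_one) (hmod : hasEntireLFunction_rat)
    (h3per : realPeriodRat_eq_unit_mul_plusPeriod_three)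
    (hr : W.analyticRank = 0) (hX : ClassX8 W 3) (hs : Surj W 3)
    (ℓ : ℕ) [Fact ℓ.Prime] (hgood : W.HasGoodReductionAtPrime ℓ)
    (hℓ9 : ℓ % 9 = 2 ∨ ℓ % 9 = 5) (ha9 : W.frobeniusTrace ℓ % 9 = 3 ∨ W.frobeniusTrace ℓ % 9 = 6)
    [NeZero (W.conductorNorm ℤ)] (D : ModularParametrizationData W (W.conductorNorm ℤ))
    (hdeg : ¬ 3 ∣ D.modularDegree) (htam : ¬ 3 ∣ W.tamagawaProduct)
    (hK : X4.KuriharaUnitAt W 3 D.f) : BSDp W 3 :=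
  X8RankZero.bsdp_of_kim2025_OPEN_of_kuriharaUnitAt_of_frobenius W 3 hKim25u hGZK hmod h3per hr hX hs ℓ
    hgood hℓ9 ha9 D
    (by exact_mod_cast ClassX8.not_three_dvd_maninConstant_of_not_dvd_modularDegree W 3 hCNS hX D hdeg)
    htam hK

/-! ### §2 APPEND (gen 17): the typed currency of `Typed/X8.lean` -/

/-- **Bookkeeping into the typed currency**: on X8 ∧ `r_an = 0` ∧ tower ∧ `3 ∤ c_D · ∏ c_ℓ`, ONE unit
Kurihara number delivers `X8.MissingInputAt W p` (`Typed/X8.lean`: in rank `0` with surj(3) it IS the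
lower bound, here obtained together with the upper one), CONDITIONAL on `hKim25u` (OPEN). Compare gen 2's
`X8.missingInputAt_of_kuriharaUnitAt_of_kksBridge` (displayed bridge). Per pair; nothing booked.
[claim: Kim2025RefinedTNC, status: under-review] [cite: Kim2025RefinedTNC, Thm. 1.1, Cor. 1.7 (ANNOUNCED, OPEN binder)]
[cite: Miller2011LMS, Def. 1.1] -/
theorem X8RankZero.missingInputAt_of_kim2025_OPEN_of_kuriharaUnitAt
    (hKim25u : Kim2025.rankZero_padicValRat_sha_of_kuriharaNumber_ne_zero_of_towerSurj_OPEN)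
    (hGZK : rank_eq_analyticRank_of_analyticRank_le_one) (hmod : hasEntireLFunction_rat)
    (h3per : realPeriodRat_eq_unit_mul_plusPeriod_three)
    (hr : W.analyticRank = 0) (hX : ClassX8 W p)
    (htower : ∀ n : ℕ, W.HasSurjectiveModNGaloisRep (p ^ n : ℕ))
    {N : ℕ} [NeZero N] (D : ModularParametrizationData W N) (hc : ¬ (p : ℤ) ∣ D.maninConstant)
    (htam : ¬ p ∣ W.tamagawaProduct) (hK : X4.KuriharaUnitAt W p D.f) : X8.MissingInputAt W p := by
  have hPP := (X8RankZero.bsdp_of_kim2025_OPEN_of_kuriharaUnitAt W p hKim25u hGZK hmod h3per hr hX htower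
    D hc htam hK).2
  exact ⟨fun _ _ ↦ (lower_and_upper_of_missingPPartAt W p hPP).1, fun _ ↦ hPP⟩

end Summit.BirchSwinnertonDyer.Rank1Residual.Supersingular

end
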